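import Summits.NavierStokesRegularity.NavierStokesRegularity.Theorems.TypeILiouvilleTypeIliouvilleLWeakL3TailOfDecay
import HarnessLib

/-!
# The `|x|⁻¹` wake is exactly the threshold of the vanishing-tail criterion (crux `TypeIliouvilleL`,
# stmt-NavierStokesRegularity-10661, persistent stub S3ᵐ): tightness of `…WeakL3TailOfDecay`

Helper file (theorems only, no definition, no named fact, no `sorry`; lands
`--supports stmt-NavierStokesRegularity-10661`). Companion of `…WeakL3VanishingTail`,
`…WeakL3TailOfLp`, `…WeakL3TailOfDecay`: those kill a weak-`L³`-recurrent mild bounded ancient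
solution as soon as ONE recurrence slice `v(τ_{k₀}) − b` has a vanishing weak-`L³` lower tail
(`Lᵖ`, `p ≤ 3`; `o(|x|⁻¹)`). This file records, in kernel, that the criterion stops EXACTLY at the
`−1`-homogeneous wake: for the model tail `x ↦ ‖x‖⁻¹` the quantity `s³ · vol{s < ‖x‖⁻¹}` is the
CONSTANT `vol B₁` (`cube_mul_meas_lt_inv_norm`), so it is uniformly weak-`L³` but its lower tail does
not vanish (`not_tendsto_cube_mul_meas_lt_inv_norm`) — the scale-invariant obstruction behind
Albritton–Barker's `ε(M)` (arXiv:1811.00502 §4) and behind the Type-I / self-similar profiles.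

Nothing here proves S3ᵐ, (L), or anything about Navier–Stokes regularity.
-/

set_option linter.dupNamespace false

namespace Summit.NavierStokesRegularity.NavierStokesRegularity.Theorems

open MeasureTheory Filter Set Function Metric
open scoped ENNReal NNReal Topology

/-- **The `|x|⁻¹` tail is scale invariant in the weak-`L³` gauge**: for every `s > 0`,
`s³ · vol{x ∈ ℝ³ : s < ‖x‖⁻¹} = vol B(0,1)` (the superlevel set is the punctured ball
`B(0, 1/s)`). [folklore] -/
theorem cube_mul_meas_lt_inv_norm {s : ℝ} (hs : 0 < s) :
    ENNReal.ofReal s ^ 3 * (volume : Measure (EuclideanSpace ℝ (Fin 3))) {x | s < ‖x‖⁻¹} =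
      volume (ball (0 : EuclideanSpace ℝ (Fin 3)) 1) := by
  -- the superlevel set is the punctured ball of radius `1/s`
  have hsub : {x : EuclideanSpace ℝ (Fin 3) | s < ‖x‖⁻¹} ⊆ ball 0 s⁻¹ := by
    intro x hx
    simp only [mem_setOf_eq] at hx
    rw [mem_ball, dist_zero_right]
    have hx0 : 0 < ‖x‖ := by
      by_contra h
      have h0 : ‖x‖ = 0 := le_antisymm (not_lt.1 h) (norm_nonneg _)
      rw [h0, inv_zero] at hx
      exact absurd hx (not_lt.2 hs.le)
    exact (lt_inv_comm₀ hs hx0).1 hx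
  have hsup : ball (0 : EuclideanSpace ℝ (Fin 3)) s⁻¹ \ {0} ⊆ {x | s < ‖x‖⁻¹} := by
    intro x hx
    rw [Set.mem_sdiff, mem_ball, dist_zero_right, mem_singleton_iff] at hx
    have hx0 : 0 < ‖x‖ := norm_pos_iff.2 hx.2
    show s < ‖x‖⁻¹
    exact (lt_inv_comm₀ hs hx0).2 hx.1
  have hvol : (volume : Measure (EuclideanSpace ℝ (Fin 3))) {x | s < ‖x‖⁻¹} =
      volume (ball (0 : EuclideanSpace ℝ (Fin 3)) s⁻¹) := by
    refine le_antisymm (measure_mono hsub) ?_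
    calc (volume : Measure (EuclideanSpace ℝ (Fin 3))) (ball 0 s⁻¹)
        = volume (ball (0 : EuclideanSpace ℝ (Fin 3)) s⁻¹ \ {0}) :=
          (measure_sdiff_null (measure_singleton _)).symm
      _ ≤ volume {x : EuclideanSpace ℝ (Fin 3) | s < ‖x‖⁻¹} := measure_mono hsup
  rw [hvol, Measure.addHaar_ball_of_pos volume (0 : EuclideanSpace ℝ (Fin 3)) (inv_pos.2 hs),
    finrank_euclideanSpace_fin, ← mul_assoc, ← ENNReal.ofReal_pow hs.le,
    ← ENNReal.ofReal_mul (by positivity), ← mul_pow, mul_inv_cancel₀ hs.ne', one_pow,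
    ENNReal.ofReal_one, one_mul]

/-- **Hence the `|x|⁻¹` tail has NO vanishing weak-`L³` lower tail**: `s³ · vol{s < ‖x‖⁻¹}` does
not tend to `0` as `s → 0⁺` (it is the positive constant `vol B(0,1)`), so the criterion of
`oseenMild_const_of_backward_weakL3_const_of_tail` stops exactly at the `−1`-homogeneous wakes
(Albritton–Barker's `ε(M)`). [cite: AlbrittonBarker2019, §4 (arXiv:1811.00502 p. 9), the class 𝔹] -/
theorem not_tendsto_cube_mul_meas_lt_inv_norm :
    ¬ Tendsto (fun s : ℝ => ENNReal.ofReal s ^ 3 *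
        (volume : Measure (EuclideanSpace ℝ (Fin 3))) {x : EuclideanSpace ℝ (Fin 3) | s < ‖x‖⁻¹})
      (𝓝[>] 0) (𝓝 0) := by
  intro h
  have hconst : ∀ᶠ s in 𝓝[>] (0 : ℝ), ENNReal.ofReal s ^ 3 *
      (volume : Measure (EuclideanSpace ℝ (Fin 3))) {x : EuclideanSpace ℝ (Fin 3) | s < ‖x‖⁻¹} =
        volume (ball (0 : EuclideanSpace ℝ (Fin 3)) 1) :=
    eventually_nhdsWithin_of_forall fun s hs => cube_mul_meas_lt_inv_norm hs
  have h1 : Tendsto (fun _ : ℝ => (volume : Measure (EuclideanSpace ℝ (Fin 3))) (ball 0 1))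
      (𝓝[>] (0 : ℝ)) (𝓝 0) := h.congr' hconst
  have h2 := tendsto_nhds_unique h1 tendsto_const_nhds
  exact (measure_ball_pos (volume : Measure (EuclideanSpace ℝ (Fin 3))) 0 one_pos).ne' h2.symm

end Summit.NavierStokesRegularity.NavierStokesRegularity.Theorems
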